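import Summits.Ventures.HSemireg.WedgeHankelRecurrenceCensus

/-!
# Venture HSemireg — SQUARE HANKEL MATRICES OVER A FINITE FIELD BY RANK AND DETERMINANT: of the `s^{2t+1}` Hankel matrices `(v_{i+j})_{i,j ≤ t}` over a field with `s` elements
# **exactly `s^{2t}` are singular and `(s − 1)·s^{2t}` nonsingular** (a random square Hankel matrix is singular with probability exactly `1/s`, whatever its size), and `(s² − 1)·s^{2r−2}`
# have rank `r` for `1 ≤ r ≤ t` — the census of N44 read on determinants

HONEST FRAMING. Part of the Lean index of the computation cell `pub-hsemireg` (seat p10 gen 28, Sunday typer «UNIFORM-IN-n»).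
LINEAR ALGEBRA OF HANKEL (catalecticant) MATRICES over a field ONLY: no variety, no cohomology theory, no sheaf, no Ext group and no semiregularity map is constructed here; nothing here
says that HC / HC_CM / HC_AV holds; no Literature fact is declared or used.  Custodian versions as in `WedgeHankelSiegelIdeal` (1/3).  READING (classical, not used): Daykin 1960
(J. reine angew. Math. 203); García-Armas–Ghorpade–Ram 2011 (nonsingular Hankel ∕ Toeplitz matrices over `F_q`); Dwivedi–Grinberg 2022 (arXiv:2109.05415).

WHAT IS KEYED / IN THE TREE.  N44 (`WedgeHankelRecurrenceCensus`, p10 g28 claim #2): `seqOf`, `ncard_setOf_rank_half_eq_top`, `ncard_setOf_rank_half_le`, `ncard_setOf_rank_half_eq`,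
`ncard_setOf_rank_half_eq_zero`; `hankel1` (`WedgeHankelModel`).  Mathlib: `Matrix.rank` (= `finrank (range mulVecLin)`), `Matrix.rank_submatrix`, `Matrix.mulVec_surjective_iff_isUnit`,
`Matrix.isUnit_iff_isUnit_det`, `LinearMap.range_eq_top`, `Submodule.eq_top_of_finrank_eq`, `finCongr`, `Set.ncard_compl`, `Nat.card_fun`.
THIS FILE (namespace `Summit.Ventures.HSemireg.Wedge.HankelOuter` continued; CHAINED on N44; 1 definition `hankelSq`):
* §555 `hankelSq K t q` = the square Hankel matrix `(q_{i+j})_{i, j ≤ t}`; `hankelSq_eq_submatrix` (it is `H^{2t}_t(q)` reindexed), **`rank_hankelSq`** (`rank = R^{2t}(q)`),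
  **`rank_hankelSq_eq_iff_det_ne_zero`** (`rank = t + 1 ↔ det ≠ 0`).
* §556 THE COUNTS (`[Finite K]`, `s = Nat.card K`, over coefficient vectors `v : Fin (2t+1) → K`): **`ncard_setOf_det_hankelSq_ne_zero`** (`(s − 1)·s^{2t}` nonsingular),
  **`ncard_setOf_det_hankelSq_eq_zero`** (`s^{2t}` singular), **`ncard_setOf_rank_hankelSq_eq`** (`(s² − 1)·s^{2r−2}` of rank `1 ≤ r ≤ t`), `ncard_setOf_rank_hankelSq_eq_zero` (`1`),
  `ncard_setOf_rank_hankelSq_le` (`s^{2r}` of rank `≤ r ≤ t`).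
Nothing Ext-side.  New names only.
-/

open Module Polynomial
open scoped Matrix Polynomial

namespace Summit.Ventures.HSemireg.Wedge.HankelOuter

open Summit.Ventures.HSemireg.Wedge Summit.Ventures.HSemireg.Wedge.Hankel

variable (K : Type*) [Field K]

/-! ## §555. The square Hankel matrix of a class on `[0, 2t]`: rank = middle rank, full rank ↔ non-zero determinant -/

/-- THE SQUARE HANKEL MATRIX `(q_{i+j})_{i, j ≤ t}` of a coefficient sequence (`(t+1) × (t+1)`; it is `H^{2t}_t(q)` with its column index retyped). [definition of this file] -/
def hankelSq (t : ℕ) (q : ℕ → K) : Matrix (Fin (t + 1)) (Fin (t + 1)) K := Matrix.of fun i j => q ((i : ℕ) + (j : ℕ))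

omit [Field K] in
/-- `hankelSq t q` is the middle catalecticant `H^{2t}_t(q)` reindexed. -/
theorem hankelSq_eq_submatrix (t : ℕ) (q : ℕ → K) :
    hankelSq K t q = (hankel1 K (2 * t) t q).submatrix id (finCongr (by omega : t + 1 = 2 * t + 1 - t)) := by
  ext i j
  simp only [hankelSq, hankel1, Matrix.submatrix_apply, Matrix.of_apply, id, finCongr_apply, Fin.val_cast]

/-- **`rank (hankelSq t q) = R^{2t}(q)`**, the middle rank of the class on `[0, 2t]`. -/
theorem rank_hankelSq (t : ℕ) (q : ℕ → K) : (hankelSq K t q).rank = (hankel1 K (2 * t) (2 * t / 2) q).rank := by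
  rw [hankelSq_eq_submatrix, show (id : Fin (t + 1) → Fin (t + 1)) = (Equiv.refl (Fin (t + 1)) : Fin (t + 1) → Fin (t + 1)) from rfl, Matrix.rank_submatrix,
    show 2 * t / 2 = t by omega]

/-- **full rank ↔ non-zero determinant: `rank (hankelSq t q) = t + 1 ↔ det (hankelSq t q) ≠ 0`** (square matrices over a field). -/
theorem rank_hankelSq_eq_iff_det_ne_zero (t : ℕ) (q : ℕ → K) : (hankelSq K t q).rank = t + 1 ↔ (hankelSq K t q).det ≠ 0 := by
  rw [← isUnit_iff_ne_zero, ← Matrix.isUnit_iff_isUnit_det, ← Matrix.mulVec_surjective_iff_isUnit, ← Matrix.coe_mulVecLin, ← LinearMap.range_eq_top]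
  constructor
  · intro h
    exact Submodule.eq_top_of_finrank_eq (by rw [Module.finrank_fin_fun]; exact h)
  · intro h
    rw [Matrix.rank, h, finrank_top, Module.finrank_fin_fun]

/-! ## §556. The counts: singular, nonsingular, and by rank -/

/-- **THE NONSINGULAR SQUARE HANKEL MATRICES: of the `s^{2t+1}` matrices `(v_{i+j})_{i,j ≤ t}` over a finite field with `s` elements exactly `(s − 1)·s^{2t}` have non-zero determinant**
(N44's generic classes of the even level `2t`). -/
theorem ncard_setOf_det_hankelSq_ne_zero [Finite K] (t : ℕ) :
    {v : Fin (2 * t + 1) → K | (hankelSq K t (seqOf K v)).det ≠ 0}.ncard = (Nat.card K - 1) * Nat.card K ^ (2 * t) := by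
  rw [← ncard_setOf_rank_half_eq_top K t]
  congr 1
  ext v
  rw [Set.mem_setOf_eq, Set.mem_setOf_eq, ← rank_hankelSq_eq_iff_det_ne_zero, rank_hankelSq]

/-- **… and exactly `s^{2t}` are SINGULAR** — probability exactly `1/s`, for every size (the classes of middle rank `≤ t`, N44's cumulative census). -/
theorem ncard_setOf_det_hankelSq_eq_zero [Finite K] (t : ℕ) : {v : Fin (2 * t + 1) → K | (hankelSq K t (seqOf K v)).det = 0}.ncard = Nat.card K ^ (2 * t) := by
  rw [← ncard_setOf_rank_half_le K (N := 2 * t) (r := t) (by omega)]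
  congr 1
  ext v
  have hle : (hankelSq K t (seqOf K v)).rank ≤ t + 1 := Matrix.rank_le_height _
  rw [Set.mem_setOf_eq, Set.mem_setOf_eq, ← rank_hankelSq, ← not_iff_not, ← Ne, ← rank_hankelSq_eq_iff_det_ne_zero, not_le]
  omega

/-- **BY RANK: for `1 ≤ r ≤ t` exactly `(s² − 1)·s^{2r−2}` of the square Hankel matrices `(v_{i+j})_{i,j ≤ t}` have rank `r`.** -/
theorem ncard_setOf_rank_hankelSq_eq [Finite K] {t r : ℕ} (hr : 1 ≤ r) (hrt : r ≤ t) :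
    {v : Fin (2 * t + 1) → K | (hankelSq K t (seqOf K v)).rank = r}.ncard = (Nat.card K ^ 2 - 1) * Nat.card K ^ (2 * r - 2) := by
  rw [← ncard_setOf_rank_half_eq K (N := 2 * t) hr (by omega)]
  congr 1
  ext v
  rw [Set.mem_setOf_eq, Set.mem_setOf_eq, rank_hankelSq]

/-- only the zero matrix has rank `0`. -/
theorem ncard_setOf_rank_hankelSq_eq_zero [Finite K] (t : ℕ) : {v : Fin (2 * t + 1) → K | (hankelSq K t (seqOf K v)).rank = 0}.ncard = 1 := by
  refine Eq.trans ?_ (ncard_setOf_rank_half_eq_zero K (2 * t))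
  congr 1
  ext v
  rw [Set.mem_setOf_eq, Set.mem_setOf_eq, rank_hankelSq]

/-- **cumulatively: exactly `s^{2r}` of the square Hankel matrices `(v_{i+j})_{i,j ≤ t}` have rank `≤ r`** (`r ≤ t`). -/
theorem ncard_setOf_rank_hankelSq_le [Finite K] {t r : ℕ} (hrt : r ≤ t) : {v : Fin (2 * t + 1) → K | (hankelSq K t (seqOf K v)).rank ≤ r}.ncard = Nat.card K ^ (2 * r) := by
  rw [← ncard_setOf_rank_half_le K (N := 2 * t) (r := r) (by omega)]
  congr 1
  ext v
  rw [Set.mem_setOf_eq, Set.mem_setOf_eq, rank_hankelSq]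

end Summit.Ventures.HSemireg.Wedge.HankelOuter
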